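import Literature.MathematicalPhysics.QuantumFieldTheory.Balaban1983to89.B9Eq324ConjugatedFormDifference

/-!
# `Balaban1983to89.B9Eq326ConjugatedDeltaAFormDefect` — T. Bałaban, *Propagators for lattice gauge theories in a background field*, Commun. Math. Phys.
# **99** (1985) 389–434 [Balaban1985BackgroundPropagators] (3.24) p. 394, (3.26) p. 395, (3.49) p. 399, (3.52)–(3.53) and Thm 3.4 p. 400, (3.84)–(3.86)
# p. 407: **THE TWO-BACKGROUND FORM DEFECT OF TWO CONJUGATED `Δ_a`-STRUCTURES FROM LETTERS — `|⟪u, H_κ(U)v⟫ − ⟪u, H_κ(V)v⟫| ≤ Θ·N(u)N(v)` in ANY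
# weight `N ≥ ‖·‖`, with `Θ` BILINEAR in (size letters at `U`) × (difference letters `V − U`) — and the FOUR-TERM MINKOWSKI comparison of two covariant
# energy weights `N_U ≤ (1 + d₁ + d₂ + d_R(1+C_P) + √a·d_Q)·N_V`** — abstract finite-dimensional `𝕜`-Hilbert letters; the `hT` and `hcmp` binders of this lineage's
# `B9Eq326ConjugatedDeltaAEnergyWeight` §4 (road (α) of t4-ne9-idea-1's N52, abstract half, item (B))

statement-level skeleton of published theorems with citation tags; proofs where landed; nothing here is a claim about the Yang–Mills mass gap

CITATION HEADER (lean-in-tree rule).  Audit cell `pub-balaban`, sub-cell `t4`, BINDER row NE9; filed by NE9 formalisation-swarm LEAF PROVER 01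
(`b2b-balaban-t4-ne9-formalise-leaf-01`, gen 88) under the fallback offer O-leaf01-g88-1 on t4-ne9-idea-1 gen 151's located note N52 §2 road (α), item (B)
(«the conjugated two-background FORM defect `|⟪u,(H_κ(U) − H_κ(V))v⟫| ≤ Θ_κN_U(u)N_U(v)`, `Θ_κ ∝ δ` — Gram brackets … CONJUGATE THE DIFFERENCE, do not
difference the conjugates»; cell journal 2026-08-25 l.62985) — the piece N52's scratch kernel names but does not type.  Imports ne9-leaf-06's
`B9Eq324ConjugatedFormDifference` (§0 Gram tools `inner_sub_inner_eq`, `norm_le_of_inner_eq_inner`) only; Mathlib otherwise.  Sources READ first-hand in the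
held text layer (`paper:balaban1985-cmp99-background-propagators`, journal page = PDF page + 388): p. 394 (3.24) (the sesquilinear form of `Δ′ + a′Q′*Q′`),
p. 395 (3.26) *«Δ_a(U) = Δ(U) + D_UR(U)D*_U + Q*(U)aQ(U)»*, p. 399 (3.49) (the exponential weights), p. 400 (3.52)–(3.53) *«Δ_{U′U} = Δ_U − V₁(A)»* and Thm 3.4
*«we prove quantitative statements which are more precise, describing these analytic extensions as small perturbations of the operators depending on U
only»*, p. 407 (3.84)–(3.86).  Print's perturbation in the background is the Neumann series (3.86); the conjugation and the energy-norm form-defect argument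
are the ROUTE's (`t4/ROUTES-NE9.md` §L1.2 R2′ road B8″, §L1.4 EXAMINED gen 151 N52); nothing of print is asserted.

WHY THIS FILE (N52 §2 (B), the abstract half).  `B9Eq326ConjugatedDeltaAEnergyWeight.norm_rightInv_sub_rightInv_le_of_coercive` turns four data into
`‖G_κ(V)y − G_κ(U)y‖ ≤ (Θ∕γ′)C₀‖y‖`: the coercivities of `H_κ(U)`, `H_κ(V)` in the covariant energy weights `N_U`, `N_V` (its §2 `coerciveN_k`), a FORM DEFECT
`Θ` of `H_κ(U) − H_κ(V)` in `N_U` (its `hT` binder) and a comparison `N_U ≤ (1 + δ_N)·N_V` (its `hcmp` binder).  The form of the CONJUGATED structure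
`H_κ = B′_{1,κ}B_{1,κ} + B′_{2,κ}R_κB_{2,κ} + K_κ + aQ′_κQ_κ` is NOT a sum of Gram squares — `⟪u, B′_{1,κ}(B_{1,κ}v)⟫ = ⟪B′_{1,κ}†u, B_{1,κ}v⟫` with
`B′_{1,κ}† ≠ B_{1,κ}` (conjugation by `−κ̄` against `κ`) — so `B9Eq386GreenLipschitzEnergy.norm_inner_sub_inner_le` (same map on both sides) does not apply
and the defect is assembled from TWO-SIDED brackets (§1) with sizes at `U` only and differences `V − U`; the adjoint sides are reached by ONE adjoint transfer
(§1 `norm_adjoint_sub_le_of_norm_sub_adjoint_le`).  The sequel `B9Eq326ConjugatedDeltaATwoBackgrounds` supplies §2's letters for `N = N_U` from (CDA)'s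
primitive conjugation letters `β, ρ, C_P` and the CONJUGATED two-background letters `δ_i` (at the lattice: zeroth-order LOCAL differences conjugated, `∝ δ`
with no `η⁻¹` — the junction's business), and §3's `d`'s are the UNconjugated differences.

WHAT IS PROVED (sorry-free; proof lane — no `def`; [folklore] finite-dimensional Hilbert-space algebra and real arithmetic).
* §1 **`norm_inner_sub_inner_le_weight`** (`‖⟪A⁻u, A⁺v⟫ − ⟪A⁻₀u, A⁺₀v⟫‖ ≤ (M⁻e⁺ + e⁻M⁺ + e⁻e⁺)·N(u)N(v)` from sizes of `A^±₀` and differences `A^± − A^±₀`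
  in the weight `N`), **`norm_adjoint_sub_le_of_norm_sub_adjoint_le`** (`‖Xp − B†p‖ ≤ c‖p‖ ∀p ⟹ ‖X†u − Bu‖ ≤ c‖u‖`), **`norm_adjoint_sub_adjoint_le`**
  (`‖Xp − Yp‖ ≤ c‖p‖ ∀p ⟹ ‖X†u − Y†u‖ ≤ c‖u‖`).
* §2 **`inner_conjH_eq`** (`⟪u, H_κv⟫ = ⟪B′_{1,κ}†u, B_{1,κ}v⟫ + ⟪B′_{2,κ}†u, R_κ(B_{2,κ}v)⟫ + ⟪u, K_κv⟫ + a⟪Q′_κ†u, Q_κv⟫`) and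
  **`norm_inner_conjH_sub_conjH_le`** — for two conjugated structures `H_κ(U)`, `H_κ(V)` and ANY weight `N ≥ ‖·‖`, size letters at `U`
  (`‖B_{1,κ}(U)v‖ ≤ m₁N(v)`, `‖B′_{1,κ}(U)†u‖ ≤ m′₁N(u)`, `‖R_κ(U)B_{2,κ}(U)v‖ ≤ m₂N(v)`, `‖B′_{2,κ}(U)†u‖ ≤ m′₂N(u)`, `|a|‖Q_κ(U)v‖ ≤ m_QN(v)`,
  `|a|‖Q′_κ(U)†u‖ ≤ m′_QN(u)`) and difference letters `V − U` in the weight (`e₁, e′₁, e₂, e′₂, e_Q, e′_Q, e_K`):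
  `‖⟪u, H_κ(U)v⟫ − ⟪u, H_κ(V)v⟫‖ ≤ ((m′₁e₁ + e′₁m₁ + e′₁e₁) + (m′₂e₂ + e′₂m₂ + e′₂e₂) + e_K + (m′_Qe_Q + e′_Qm_Q + |a|e′_Qe_Q))·N(u)N(v)`.
* §3 **`sqrt_four_sq_le`** (`√(x₁² + x₂² + x₃² + t²) ≤ √(y₁² + y₂² + y₃² + t²) + Σ|x_i − y_i|`) and **`weightU_le_weightV_mul`**
  (`N_U(f) ≤ (1 + d₁ + d₂ + d_R(1+C_P) + √a·d_Q)·N_V(f)` from the ZEROTH-order letters `‖B₁(U) − B₁(V)‖ ≤ d₁`, `‖B₂(U) − B₂(V)‖ ≤ d₂`, `‖R(U) − R(V)‖ ≤ d_R`,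
  `‖Q(U) − Q(V)‖ ≤ d_Q` with `‖R(U)‖ ≤ 1` and `V`'s `C_P` — the first-order factor `B₂(V)f` is measured against `N_V(f)`, never against `‖f‖`).
MODEL ∕ HONEST SCOPE.  (M1) abstract letters; `E` finite-dimensional where adjoints occur.  (M2) every size ∕ difference letter DISPLAYED (suppliers: the sequel's
§1 from (CDA)'s `β, ρ, C_P` and the conjugated ∕ unconjugated two-background letters, themselves displayed there).  (M3) first order in `V − U`; `Θ` crude
(no symmetry used, `|a|` carried by the `Q` sizes so that `a = 0` is harmless).  (M4) no lattice object, no rate, no window; nothing of [B9] Thm 3.4's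
analyticity or (3.86)'s Neumann series.  NOT NE9 (cell pub-balaban: NE9 NOT PRINTED ∕ NOT PROVED; «NE9 ⇐ the named binders»; row WALLED ON A MODEL (O-NE9-1;
#5 UNRULED); spine PROVED 0∕9; rung (B)+1 on a finite T⁴ — NOT infinite volume, NOT mass gap, NOT BetaPertH, NOT Clay).  HONEST DEPENDENCY (cell line):
continuum YM on T⁴ ⇐ BetaPertH ∧ nine spine estimates (0/9 proved); BetaPertH ⇐ (D1) ∧ (D4) ∧ CAP+tail; G-an2-4 gates asym, D1 and NE2/3/4.  NEW file;
nothing modified.  Net new unproved facts: 0.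
-/

noncomputable section

open scoped InnerProductSpace ComplexConjugate

namespace Literature.MathematicalPhysics.QuantumFieldTheory.Balaban1983to89.B9Eq326ConjugatedDeltaAFormDefect

open B9Eq324ConjugatedFormDifference (inner_sub_inner_eq norm_le_of_inner_eq_inner)

variable {𝕜 : Type*} [RCLike 𝕜]
  {E : Type*} [NormedAddCommGroup E] [InnerProductSpace 𝕜 E] [FiniteDimensional 𝕜 E]
  {P : Type*} [NormedAddCommGroup P] [InnerProductSpace 𝕜 P] [FiniteDimensional 𝕜 P]
  {S : Type*} [NormedAddCommGroup S] [InnerProductSpace 𝕜 S] [FiniteDimensional 𝕜 S]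
  {F : Type*} [NormedAddCommGroup F] [InnerProductSpace 𝕜 F] [FiniteDimensional 𝕜 F]

/-! ## §1 Gram tools in a weight -/

section Gram

variable {X : Type*} {V : Type*} [NormedAddCommGroup V] [InnerProductSpace 𝕜 V]

/-- **THE TWO-SIDED BRACKET IN A WEIGHT**: for maps `A⁻, A⁻₀, A⁺, A⁺₀ : X → V` and a weight `N ≥ 0` with `‖A⁻w − A⁻₀w‖ ≤ e⁻N(w)`, `‖A⁺w − A⁺₀w‖ ≤ e⁺N(w)`,
`‖A⁻₀w‖ ≤ M⁻N(w)`, `‖A⁺₀w‖ ≤ M⁺N(w)` (sizes on the `₀` side ONLY):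
`‖⟪A⁻u, A⁺v⟫ − ⟪A⁻₀u, A⁺₀v⟫‖ ≤ (M⁻e⁺ + e⁻M⁺ + e⁻e⁺)·N(u)N(v)` — `B9Eq324ConjugatedFormDifference.inner_sub_inner_eq`:
`⟪u′, v′⟫ − ⟪u, v⟫ = ⟪u, v′ − v⟫ + ⟪u′ − u, v⟫ + ⟪u′ − u, v′ − v⟫`. [folklore] [cite: Balaban1985BackgroundPropagators, (3.24) p.394, (3.52)–(3.53) p.400] -/
theorem norm_inner_sub_inner_le_weight (Am Am₀ Ap Ap₀ : X → V) (N : X → ℝ) (hN : ∀ w, 0 ≤ N w) {em ep Mm Mp : ℝ}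
    (hem : 0 ≤ em) (hMm : 0 ≤ Mm)
    (dm : ∀ w, ‖Am w - Am₀ w‖ ≤ em * N w) (dp : ∀ w, ‖Ap w - Ap₀ w‖ ≤ ep * N w)
    (sm : ∀ w, ‖Am₀ w‖ ≤ Mm * N w) (sp : ∀ w, ‖Ap₀ w‖ ≤ Mp * N w) (u v : X) :
    ‖⟪Am u, Ap v⟫_𝕜 - ⟪Am₀ u, Ap₀ v⟫_𝕜‖ ≤ (Mm * ep + em * Mp + em * ep) * N u * N v := by
  rw [inner_sub_inner_eq (Am₀ u) (Am u) (Ap₀ v) (Ap v)]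
  have h1 : ‖⟪Am₀ u, Ap v - Ap₀ v⟫_𝕜‖ ≤ Mm * N u * (ep * N v) :=
    (norm_inner_le_norm _ _).trans (mul_le_mul (sm u) (dp v) (norm_nonneg _) (mul_nonneg hMm (hN u)))
  have h2 : ‖⟪Am u - Am₀ u, Ap₀ v⟫_𝕜‖ ≤ em * N u * (Mp * N v) :=
    (norm_inner_le_norm _ _).trans (mul_le_mul (dm u) (sp v) (norm_nonneg _) (mul_nonneg hem (hN u)))
  have h3 : ‖⟪Am u - Am₀ u, Ap v - Ap₀ v⟫_𝕜‖ ≤ em * N u * (ep * N v) :=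
    (norm_inner_le_norm _ _).trans (mul_le_mul (dm u) (dp v) (norm_nonneg _) (mul_nonneg hem (hN u)))
  calc ‖⟪Am₀ u, Ap v - Ap₀ v⟫_𝕜 + ⟪Am u - Am₀ u, Ap₀ v⟫_𝕜 + ⟪Am u - Am₀ u, Ap v - Ap₀ v⟫_𝕜‖
      ≤ ‖⟪Am₀ u, Ap v - Ap₀ v⟫_𝕜‖ + ‖⟪Am u - Am₀ u, Ap₀ v⟫_𝕜‖ + ‖⟪Am u - Am₀ u, Ap v - Ap₀ v⟫_𝕜‖ := norm_add₃_le
    _ ≤ Mm * N u * (ep * N v) + em * N u * (Mp * N v) + em * N u * (ep * N v) := add_le_add (add_le_add h1 h2) h3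
    _ = (Mm * ep + em * Mp + em * ep) * N u * N v := by ring

end Gram

/-- **ADJOINT TRANSFER**: `‖Xp − B†p‖ ≤ c‖p‖` for all `p` ⟹ `‖X†u − Bu‖ ≤ c‖u‖` for all `u` — `⟪X†u − Bu, p⟫ = ⟪u, Xp − B†p⟫` and
`B9Eq324ConjugatedFormDifference.norm_le_of_inner_eq_inner`.  (So the conjugation letter `‖B′_{i,κ} − B_i†‖ ≤ β` of (CDA) bounds `B′_{i,κ}†` against `B_i`.)
[folklore] [cite: Balaban1985BackgroundPropagators, (3.24) p.394, (3.49) p.399] -/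
theorem norm_adjoint_sub_le_of_norm_sub_adjoint_le {X : P →ₗ[𝕜] E} {B : E →ₗ[𝕜] P} {c : ℝ} (hc : 0 ≤ c)
    (h : ∀ p, ‖X p - LinearMap.adjoint B p‖ ≤ c * ‖p‖) (u : E) : ‖LinearMap.adjoint X u - B u‖ ≤ c * ‖u‖ := by
  refine norm_le_of_inner_eq_inner (𝕜 := 𝕜) (K := fun u => LinearMap.adjoint X u - B u) (L := fun p => X p - LinearMap.adjoint B p) hc ?_ h u
  intro h' z
  simp only [inner_sub_left, inner_sub_right, LinearMap.adjoint_inner_left, LinearMap.adjoint_inner_right]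

/-- **ADJOINT TRANSFER OF A TWO-BACKGROUND LETTER**: `‖Xp − Yp‖ ≤ c‖p‖` for all `p` ⟹ `‖X†u − Y†u‖ ≤ c‖u‖` (`Y = (Y†)†`). [folklore]
[cite: Balaban1985BackgroundPropagators, (3.24) p.394, (3.52)–(3.53) p.400] -/
theorem norm_adjoint_sub_adjoint_le {X Y : P →ₗ[𝕜] E} {c : ℝ} (hc : 0 ≤ c) (h : ∀ p, ‖X p - Y p‖ ≤ c * ‖p‖) (u : E) :
    ‖LinearMap.adjoint X u - LinearMap.adjoint Y u‖ ≤ c * ‖u‖ :=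
  norm_adjoint_sub_le_of_norm_sub_adjoint_le (B := LinearMap.adjoint Y) hc (fun p => by rw [LinearMap.adjoint_adjoint]; exact h p) u

/-! ## §2 The form of the conjugated structure and the two-background form defect from letters -/

section Defect

variable {B₁kU B₁kV : E →ₗ[𝕜] P} {B₁k'U B₁k'V : P →ₗ[𝕜] E} {B₂kU B₂kV : E →ₗ[𝕜] S} {B₂k'U B₂k'V : S →ₗ[𝕜] E} {RkU RkV : S →ₗ[𝕜] S}
  {QkU QkV : E →ₗ[𝕜] F} {Qk'U Qk'V : F →ₗ[𝕜] E} {KkU KkV HkU HkV : E →ₗ[𝕜] E} {a : ℝ}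

omit [FiniteDimensional 𝕜 E] in
/-- **THE FORM OF THE CONJUGATED STRUCTURE**: `⟪u, H_κv⟫ = ⟪B′_{1,κ}†u, B_{1,κ}v⟫ + ⟪B′_{2,κ}†u, R_κ(B_{2,κ}v)⟫ + ⟪u, K_κv⟫ + a⟪Q′_κ†u, Q_κv⟫` for
`H_κf = B′_{1,κ}(B_{1,κ}f) + B′_{2,κ}(R_κ(B_{2,κ}f)) + K_κf + a•Q′_κ(Q_κf)` — the conjugated (3.24)∕(3.26) as a sum of TWO-SIDED brackets. [folklore]
[cite: Balaban1985BackgroundPropagators, (3.24) p.394, (3.26) p.395, (3.49) p.399] -/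
theorem inner_conjH_eq [FiniteDimensional 𝕜 E]
    (hHk : ∀ f, HkU f = B₁k'U (B₁kU f) + B₂k'U (RkU (B₂kU f)) + KkU f + ((a : ℝ) : 𝕜) • Qk'U (QkU f)) (u v : E) :
    ⟪u, HkU v⟫_𝕜 = ⟪LinearMap.adjoint B₁k'U u, B₁kU v⟫_𝕜 + ⟪LinearMap.adjoint B₂k'U u, RkU (B₂kU v)⟫_𝕜 + ⟪u, KkU v⟫_𝕜 +
      ((a : ℝ) : 𝕜) * ⟪LinearMap.adjoint Qk'U u, QkU v⟫_𝕜 := by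
  rw [hHk, inner_add_right, inner_add_right, inner_add_right, inner_smul_right, LinearMap.adjoint_inner_left, LinearMap.adjoint_inner_left,
    LinearMap.adjoint_inner_left]

/-- **THE CONJUGATED TWO-BACKGROUND FORM DEFECT FROM LETTERS.**  Two conjugated `Δ_a`-structures `H_κ(U)`, `H_κ(V)` (same `κ`, `χ`, `a`; same spaces), a weight
`N ≥ ‖·‖`, SIZE letters at `U` (`‖B_{1,κ}(U)v‖ ≤ m₁N(v)`, `‖B′_{1,κ}(U)†u‖ ≤ m′₁N(u)`, `‖R_κ(U)B_{2,κ}(U)v‖ ≤ m₂N(v)`, `‖B′_{2,κ}(U)†u‖ ≤ m′₂N(u)`,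
`|a|‖Q_κ(U)v‖ ≤ m_QN(v)`, `|a|‖Q′_κ(U)†u‖ ≤ m′_QN(u)`) and DIFFERENCE letters `V − U` (`e₁, e′₁, e₂, e′₂, e_Q, e′_Q, e_K` in the weight) give
`‖⟪u, H_κ(U)v⟫ − ⟪u, H_κ(V)v⟫‖ ≤ ((m′₁e₁ + e′₁m₁ + e′₁e₁) + (m′₂e₂ + e′₂m₂ + e′₂e₂) + e_K + (m′_Qe_Q + e′_Qm_Q + |a|e′_Qe_Q))·N(u)N(v)` — the `hT` binder of
`B9Eq326ConjugatedDeltaAEnergyWeight.norm_rightInv_sub_rightInv_le`; §1's bracket three times plus the bounded `K`-slot. [folklore]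
[cite: Balaban1985BackgroundPropagators, (3.52)–(3.53) p.400, (3.84)–(3.86) p.407, (3.24) p.394, (3.26) p.395, (3.49) p.399] -/
theorem norm_inner_conjH_sub_conjH_le
    (hHkU : ∀ f, HkU f = B₁k'U (B₁kU f) + B₂k'U (RkU (B₂kU f)) + KkU f + ((a : ℝ) : 𝕜) • Qk'U (QkU f))
    (hHkV : ∀ f, HkV f = B₁k'V (B₁kV f) + B₂k'V (RkV (B₂kV f)) + KkV f + ((a : ℝ) : 𝕜) • Qk'V (QkV f))
    (N : E → ℝ) (hN : ∀ w, 0 ≤ N w) (hNn : ∀ w, ‖w‖ ≤ N w)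
    {m₁ m₁' m₂ m₂' mQ mQ' e₁ e₁' e₂ e₂' eQ eQ' eK : ℝ} (hm₁' : 0 ≤ m₁') (hm₂' : 0 ≤ m₂') (hmQ' : 0 ≤ mQ')
    (he₁' : 0 ≤ e₁') (he₂' : 0 ≤ e₂') (heQ' : 0 ≤ eQ')
    (s₁ : ∀ v, ‖B₁kU v‖ ≤ m₁ * N v) (s₁' : ∀ u, ‖LinearMap.adjoint B₁k'U u‖ ≤ m₁' * N u)
    (s₂ : ∀ v, ‖RkU (B₂kU v)‖ ≤ m₂ * N v) (s₂' : ∀ u, ‖LinearMap.adjoint B₂k'U u‖ ≤ m₂' * N u)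
    (sQ : ∀ v, |a| * ‖QkU v‖ ≤ mQ * N v) (sQ' : ∀ u, |a| * ‖LinearMap.adjoint Qk'U u‖ ≤ mQ' * N u)
    (d₁ : ∀ v, ‖B₁kV v - B₁kU v‖ ≤ e₁ * N v) (d₁' : ∀ u, ‖LinearMap.adjoint B₁k'V u - LinearMap.adjoint B₁k'U u‖ ≤ e₁' * N u)
    (d₂ : ∀ v, ‖RkV (B₂kV v) - RkU (B₂kU v)‖ ≤ e₂ * N v) (d₂' : ∀ u, ‖LinearMap.adjoint B₂k'V u - LinearMap.adjoint B₂k'U u‖ ≤ e₂' * N u)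
    (dQ : ∀ v, ‖QkV v - QkU v‖ ≤ eQ * N v) (dQ' : ∀ u, ‖LinearMap.adjoint Qk'V u - LinearMap.adjoint Qk'U u‖ ≤ eQ' * N u)
    (dK : ∀ v, ‖KkV v - KkU v‖ ≤ eK * N v) (u v : E) :
    ‖⟪u, HkU v⟫_𝕜 - ⟪u, HkV v⟫_𝕜‖ ≤
      ((m₁' * e₁ + e₁' * m₁ + e₁' * e₁) + (m₂' * e₂ + e₂' * m₂ + e₂' * e₂) + eK + (mQ' * eQ + eQ' * mQ + |a| * (eQ' * eQ))) * N u * N v := by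
  rw [norm_sub_rev, inner_conjH_eq hHkV, inner_conjH_eq hHkU]
  have hNuv : 0 ≤ N u * N v := mul_nonneg (hN u) (hN v)
  -- the two first-order brackets
  have t1 := norm_inner_sub_inner_le_weight (𝕜 := 𝕜) (fun u => LinearMap.adjoint B₁k'V u) (fun u => LinearMap.adjoint B₁k'U u) (fun v => B₁kV v)
    (fun v => B₁kU v) N hN he₁' hm₁' d₁' d₁ s₁' s₁ u v
  have t2 := norm_inner_sub_inner_le_weight (𝕜 := 𝕜) (fun u => LinearMap.adjoint B₂k'V u) (fun u => LinearMap.adjoint B₂k'U u)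
    (fun v => RkV (B₂kV v)) (fun v => RkU (B₂kU v)) N hN he₂' hm₂' d₂' d₂ s₂' s₂ u v
  -- the `K`-slot
  have t3 : ‖⟪u, KkV v⟫_𝕜 - ⟪u, KkU v⟫_𝕜‖ ≤ eK * N u * N v := by
    rw [← inner_sub_right, ← LinearMap.sub_apply]
    calc ‖⟪u, (KkV - KkU) v⟫_𝕜‖ ≤ ‖u‖ * ‖(KkV - KkU) v‖ := norm_inner_le_norm _ _
      _ ≤ N u * (eK * N v) := mul_le_mul (hNn u) (by rw [LinearMap.sub_apply]; exact dK v) (norm_nonneg _) (hN u)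
      _ = eK * N u * N v := by ring
  -- the averaging slot: the coupling `|a|` is carried by the size letters
  have t4 : ‖((a : ℝ) : 𝕜) * ⟪LinearMap.adjoint Qk'V u, QkV v⟫_𝕜 - ((a : ℝ) : 𝕜) * ⟪LinearMap.adjoint Qk'U u, QkU v⟫_𝕜‖ ≤
      (mQ' * eQ + eQ' * mQ + |a| * (eQ' * eQ)) * N u * N v := by
    rw [← mul_sub, norm_mul, RCLike.norm_ofReal, inner_sub_inner_eq (LinearMap.adjoint Qk'U u) (LinearMap.adjoint Qk'V u) (QkU v) (QkV v)]
    have h1 : |a| * ‖⟪LinearMap.adjoint Qk'U u, QkV v - QkU v⟫_𝕜‖ ≤ mQ' * N u * (eQ * N v) := by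
      calc |a| * ‖⟪LinearMap.adjoint Qk'U u, QkV v - QkU v⟫_𝕜‖ ≤ |a| * (‖LinearMap.adjoint Qk'U u‖ * ‖QkV v - QkU v‖) :=
            mul_le_mul_of_nonneg_left (norm_inner_le_norm _ _) (abs_nonneg a)
        _ = (|a| * ‖LinearMap.adjoint Qk'U u‖) * ‖QkV v - QkU v‖ := by ring
        _ ≤ mQ' * N u * (eQ * N v) := mul_le_mul (sQ' u) (dQ v) (norm_nonneg _) (mul_nonneg hmQ' (hN u))
    have h2 : |a| * ‖⟪LinearMap.adjoint Qk'V u - LinearMap.adjoint Qk'U u, QkU v⟫_𝕜‖ ≤ eQ' * N u * (mQ * N v) := by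
      calc |a| * ‖⟪LinearMap.adjoint Qk'V u - LinearMap.adjoint Qk'U u, QkU v⟫_𝕜‖
          ≤ |a| * (‖LinearMap.adjoint Qk'V u - LinearMap.adjoint Qk'U u‖ * ‖QkU v‖) := mul_le_mul_of_nonneg_left (norm_inner_le_norm _ _) (abs_nonneg a)
        _ = ‖LinearMap.adjoint Qk'V u - LinearMap.adjoint Qk'U u‖ * (|a| * ‖QkU v‖) := by ring
        _ ≤ eQ' * N u * (mQ * N v) := mul_le_mul (dQ' u) (sQ v) (mul_nonneg (abs_nonneg a) (norm_nonneg _)) (mul_nonneg heQ' (hN u))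
    have h3 : |a| * ‖⟪LinearMap.adjoint Qk'V u - LinearMap.adjoint Qk'U u, QkV v - QkU v⟫_𝕜‖ ≤ |a| * (eQ' * N u * (eQ * N v)) :=
      mul_le_mul_of_nonneg_left ((norm_inner_le_norm _ _).trans (mul_le_mul (dQ' u) (dQ v) (norm_nonneg _) (mul_nonneg heQ' (hN u)))) (abs_nonneg a)
    calc |a| * ‖⟪LinearMap.adjoint Qk'U u, QkV v - QkU v⟫_𝕜 + ⟪LinearMap.adjoint Qk'V u - LinearMap.adjoint Qk'U u, QkU v⟫_𝕜 +
          ⟪LinearMap.adjoint Qk'V u - LinearMap.adjoint Qk'U u, QkV v - QkU v⟫_𝕜‖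
        ≤ |a| * (‖⟪LinearMap.adjoint Qk'U u, QkV v - QkU v⟫_𝕜‖ + ‖⟪LinearMap.adjoint Qk'V u - LinearMap.adjoint Qk'U u, QkU v⟫_𝕜‖ +
          ‖⟪LinearMap.adjoint Qk'V u - LinearMap.adjoint Qk'U u, QkV v - QkU v⟫_𝕜‖) := mul_le_mul_of_nonneg_left norm_add₃_le (abs_nonneg a)
      _ = |a| * ‖⟪LinearMap.adjoint Qk'U u, QkV v - QkU v⟫_𝕜‖ + |a| * ‖⟪LinearMap.adjoint Qk'V u - LinearMap.adjoint Qk'U u, QkU v⟫_𝕜‖ +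
          |a| * ‖⟪LinearMap.adjoint Qk'V u - LinearMap.adjoint Qk'U u, QkV v - QkU v⟫_𝕜‖ := by ring
      _ ≤ mQ' * N u * (eQ * N v) + eQ' * N u * (mQ * N v) + |a| * (eQ' * N u * (eQ * N v)) := add_le_add (add_le_add h1 h2) h3
      _ = (mQ' * eQ + eQ' * mQ + |a| * (eQ' * eQ)) * N u * N v := by ring
  -- bookkeeping
  have hsplit : ⟪LinearMap.adjoint B₁k'V u, B₁kV v⟫_𝕜 + ⟪LinearMap.adjoint B₂k'V u, RkV (B₂kV v)⟫_𝕜 + ⟪u, KkV v⟫_𝕜 +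
        ((a : ℝ) : 𝕜) * ⟪LinearMap.adjoint Qk'V u, QkV v⟫_𝕜 -
      (⟪LinearMap.adjoint B₁k'U u, B₁kU v⟫_𝕜 + ⟪LinearMap.adjoint B₂k'U u, RkU (B₂kU v)⟫_𝕜 + ⟪u, KkU v⟫_𝕜 +
        ((a : ℝ) : 𝕜) * ⟪LinearMap.adjoint Qk'U u, QkU v⟫_𝕜) =
      (⟪LinearMap.adjoint B₁k'V u, B₁kV v⟫_𝕜 - ⟪LinearMap.adjoint B₁k'U u, B₁kU v⟫_𝕜) +
      (⟪LinearMap.adjoint B₂k'V u, RkV (B₂kV v)⟫_𝕜 - ⟪LinearMap.adjoint B₂k'U u, RkU (B₂kU v)⟫_𝕜) +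
      (⟪u, KkV v⟫_𝕜 - ⟪u, KkU v⟫_𝕜) +
      (((a : ℝ) : 𝕜) * ⟪LinearMap.adjoint Qk'V u, QkV v⟫_𝕜 - ((a : ℝ) : 𝕜) * ⟪LinearMap.adjoint Qk'U u, QkU v⟫_𝕜) := by ring
  rw [hsplit]
  refine (norm_add_le _ _).trans ?_
  refine (add_le_add ((norm_add₃_le).trans (add_le_add (add_le_add t1 t2) t3)) t4).trans ?_
  apply le_of_eq; ring

end Defect

/-! ## §3 The comparison of the two weights -/

/-- **FOUR-TERM MINKOWSKI AGAINST AN `ℓ¹` BOUND**: `√(x₁² + x₂² + x₃² + t²) ≤ √(y₁² + y₂² + y₃² + t²) + (|x₁ − y₁| + |x₂ − y₂| + |x₃ − y₃|)`. [folklore]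
[cite: Balaban1985BackgroundPropagators, (3.52)–(3.53) p.400] -/
theorem sqrt_four_sq_le (x₁ x₂ x₃ y₁ y₂ y₃ t : ℝ) :
    Real.sqrt (x₁ ^ 2 + x₂ ^ 2 + x₃ ^ 2 + t ^ 2) ≤ Real.sqrt (y₁ ^ 2 + y₂ ^ 2 + y₃ ^ 2 + t ^ 2) + (|x₁ - y₁| + |x₂ - y₂| + |x₃ - y₃|) := by
  set A := Real.sqrt (y₁ ^ 2 + y₂ ^ 2 + y₃ ^ 2 + t ^ 2) with hA
  have hA0 : 0 ≤ A := Real.sqrt_nonneg _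
  have hA2 : A ^ 2 = y₁ ^ 2 + y₂ ^ 2 + y₃ ^ 2 + t ^ 2 := Real.sq_sqrt (by positivity)
  have hy₁ : |y₁| ≤ A := Real.abs_le_sqrt (by nlinarith [sq_nonneg y₂, sq_nonneg y₃, sq_nonneg t])
  have hy₂ : |y₂| ≤ A := Real.abs_le_sqrt (by nlinarith [sq_nonneg y₁, sq_nonneg y₃, sq_nonneg t])
  have hy₃ : |y₃| ≤ A := Real.abs_le_sqrt (by nlinarith [sq_nonneg y₁, sq_nonneg y₂, sq_nonneg t])
  have hB0 : 0 ≤ |x₁ - y₁| + |x₂ - y₂| + |x₃ - y₃| := by positivity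
  rw [Real.sqrt_le_left (by positivity)]
  -- `x_i² = y_i² + 2y_i(x_i − y_i) + (x_i − y_i)²`, `y_i(x_i − y_i) ≤ |y_i||x_i − y_i| ≤ A|x_i − y_i|`, `(x_i − y_i)² = |x_i − y_i|²`
  have c₁ : y₁ * (x₁ - y₁) ≤ A * |x₁ - y₁| :=
    (le_abs_self _).trans (by rw [abs_mul]; exact mul_le_mul_of_nonneg_right hy₁ (abs_nonneg _))
  have c₂ : y₂ * (x₂ - y₂) ≤ A * |x₂ - y₂| :=
    (le_abs_self _).trans (by rw [abs_mul]; exact mul_le_mul_of_nonneg_right hy₂ (abs_nonneg _))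
  have c₃ : y₃ * (x₃ - y₃) ≤ A * |x₃ - y₃| :=
    (le_abs_self _).trans (by rw [abs_mul]; exact mul_le_mul_of_nonneg_right hy₃ (abs_nonneg _))
  have s₁ : (x₁ - y₁) ^ 2 = |x₁ - y₁| ^ 2 := (sq_abs _).symm
  have s₂ : (x₂ - y₂) ^ 2 = |x₂ - y₂| ^ 2 := (sq_abs _).symm
  have s₃ : (x₃ - y₃) ^ 2 = |x₃ - y₃| ^ 2 := (sq_abs _).symm
  nlinarith [abs_nonneg (x₁ - y₁), abs_nonneg (x₂ - y₂), abs_nonneg (x₃ - y₃), mul_nonneg (abs_nonneg (x₁ - y₁)) (abs_nonneg (x₂ - y₂)),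
    mul_nonneg (abs_nonneg (x₁ - y₁)) (abs_nonneg (x₃ - y₃)), mul_nonneg (abs_nonneg (x₂ - y₂)) (abs_nonneg (x₃ - y₃))]

omit [FiniteDimensional 𝕜 E] [FiniteDimensional 𝕜 P] [FiniteDimensional 𝕜 S] [FiniteDimensional 𝕜 F] in
/-- **THE WEIGHT COMPARISON `N_U(f) ≤ (1 + δ_N)·N_V(f)`, `δ_N = d₁ + d₂ + d_R(1 + C_P) + √a·d_Q`** from the UNconjugated two-background letters
`‖B₁(U)f − B₁(V)f‖ ≤ d₁‖f‖` (curl), `‖B₂(U)f − B₂(V)f‖ ≤ d₂‖f‖` (divergence — ZEROTH order, like `d₁`), `‖R(U)s − R(V)s‖ ≤ d_R‖s‖` (the projection),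
`‖Q(U)f − Q(V)f‖ ≤ d_Q‖f‖`, with `‖R(U)s‖ ≤ ‖s‖` and `V`'s complementary bound `‖B₂(V)f − R(V)B₂(V)f‖ ≤ C_P‖f‖` — the `hcmp` binder of
`B9Eq326ConjugatedDeltaAEnergyWeight.row_of_coercive`.  CURRENCY: the unbounded factor `B₂(V)f` (first order, `∝ η⁻¹` at the lattice) is measured against
`N_V(f)` through `‖B₂(V)f‖ ≤ ‖R(V)B₂(V)f‖ + C_P‖f‖ ≤ (1 + C_P)N_V(f)`, never against `‖f‖`, so every displayed `d` is a zeroth-order letter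
(four-term Minkowski + `|‖x‖ − ‖y‖| ≤ ‖x − y‖`). [folklore] [cite: Balaban1985BackgroundPropagators, (3.52)–(3.53) p.400, Thm 3.4 p.400, (3.21) p.394, (3.26) p.395] -/
theorem weightU_le_weightV_mul {B₁U B₁V : E →ₗ[𝕜] P} {B₂U B₂V : E →ₗ[𝕜] S} {RU RV : S →ₗ[𝕜] S} {QU QV : E →ₗ[𝕜] F} {a CP d₁ d₂ dR dQ : ℝ}
    (ha : 0 ≤ a) (hCP : 0 ≤ CP) (hd₁ : 0 ≤ d₁) (hd₂ : 0 ≤ d₂) (hdR : 0 ≤ dR) (hdQ : 0 ≤ dQ) (hR1U : ∀ s, ‖RU s‖ ≤ ‖s‖)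
    (hPV : ∀ f, ‖B₂V f - RV (B₂V f)‖ ≤ CP * ‖f‖)
    (h₁ : ∀ f, ‖B₁U f - B₁V f‖ ≤ d₁ * ‖f‖) (h₂ : ∀ f, ‖B₂U f - B₂V f‖ ≤ d₂ * ‖f‖) (hR : ∀ s, ‖RU s - RV s‖ ≤ dR * ‖s‖)
    (hQ : ∀ f, ‖QU f - QV f‖ ≤ dQ * ‖f‖) (f : E) :
    Real.sqrt (‖B₁U f‖ ^ 2 + ‖RU (B₂U f)‖ ^ 2 + a * ‖QU f‖ ^ 2 + ‖f‖ ^ 2) ≤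
      (1 + (d₁ + d₂ + dR * (1 + CP) + Real.sqrt a * dQ)) * Real.sqrt (‖B₁V f‖ ^ 2 + ‖RV (B₂V f)‖ ^ 2 + a * ‖QV f‖ ^ 2 + ‖f‖ ^ 2) := by
  set NV : ℝ := Real.sqrt (‖B₁V f‖ ^ 2 + ‖RV (B₂V f)‖ ^ 2 + a * ‖QV f‖ ^ 2 + ‖f‖ ^ 2) with hNV
  have hNV0 : 0 ≤ NV := Real.sqrt_nonneg _
  have hfNV : ‖f‖ ≤ NV := by
    apply Real.le_sqrt_of_sq_le
    have : 0 ≤ a * ‖QV f‖ ^ 2 := by positivity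
    nlinarith [sq_nonneg ‖B₁V f‖, sq_nonneg ‖RV (B₂V f)‖]
  have hRNV : ‖RV (B₂V f)‖ ≤ NV := by
    apply Real.le_sqrt_of_sq_le
    have : 0 ≤ a * ‖QV f‖ ^ 2 := by positivity
    nlinarith [sq_nonneg ‖B₁V f‖, sq_nonneg ‖f‖]
  have eU : a * ‖QU f‖ ^ 2 = (Real.sqrt a * ‖QU f‖) ^ 2 := by rw [mul_pow, Real.sq_sqrt ha]
  have eV : a * ‖QV f‖ ^ 2 = (Real.sqrt a * ‖QV f‖) ^ 2 := by rw [mul_pow, Real.sq_sqrt ha]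
  rw [eU]
  have hNV' : Real.sqrt (‖B₁V f‖ ^ 2 + ‖RV (B₂V f)‖ ^ 2 + (Real.sqrt a * ‖QV f‖) ^ 2 + ‖f‖ ^ 2) = NV := by rw [hNV, eV]
  have key := sqrt_four_sq_le ‖B₁U f‖ ‖RU (B₂U f)‖ (Real.sqrt a * ‖QU f‖) ‖B₁V f‖ ‖RV (B₂V f)‖ (Real.sqrt a * ‖QV f‖) ‖f‖
  rw [hNV'] at key
  -- the three zeroth-order differences, measured against `N_V(f)`
  have a₁ : |‖B₁U f‖ - ‖B₁V f‖| ≤ d₁ * NV := (abs_norm_sub_norm_le _ _).trans ((h₁ f).trans (mul_le_mul_of_nonneg_left hfNV hd₁))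
  have hB₂V : ‖B₂V f‖ ≤ (1 + CP) * NV := by
    have := norm_add_le (RV (B₂V f)) (B₂V f - RV (B₂V f)); rw [add_sub_cancel] at this
    nlinarith [hPV f, mul_le_mul_of_nonneg_left hfNV hCP, hRNV]
  have a₂ : |‖RU (B₂U f)‖ - ‖RV (B₂V f)‖| ≤ (d₂ + dR * (1 + CP)) * NV := by
    refine (abs_norm_sub_norm_le _ _).trans ?_
    have e : RU (B₂U f) - RV (B₂V f) = RU (B₂U f - B₂V f) + (RU (B₂V f) - RV (B₂V f)) := by rw [map_sub]; abel
    rw [e]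
    calc ‖RU (B₂U f - B₂V f) + (RU (B₂V f) - RV (B₂V f))‖ ≤ ‖RU (B₂U f - B₂V f)‖ + ‖RU (B₂V f) - RV (B₂V f)‖ := norm_add_le _ _
      _ ≤ ‖B₂U f - B₂V f‖ + dR * ‖B₂V f‖ := add_le_add (hR1U _) (hR _)
      _ ≤ d₂ * NV + dR * ((1 + CP) * NV) := add_le_add ((h₂ f).trans (mul_le_mul_of_nonneg_left hfNV hd₂)) (mul_le_mul_of_nonneg_left hB₂V hdR)
      _ = (d₂ + dR * (1 + CP)) * NV := by ring
  have a₃ : |Real.sqrt a * ‖QU f‖ - Real.sqrt a * ‖QV f‖| ≤ Real.sqrt a * dQ * NV := by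
    rw [← mul_sub, abs_mul, abs_of_nonneg (Real.sqrt_nonneg a), mul_assoc]
    exact mul_le_mul_of_nonneg_left ((abs_norm_sub_norm_le _ _).trans ((hQ f).trans (mul_le_mul_of_nonneg_left hfNV hdQ))) (Real.sqrt_nonneg a)
  calc _ ≤ NV + (|‖B₁U f‖ - ‖B₁V f‖| + |‖RU (B₂U f)‖ - ‖RV (B₂V f)‖| + |Real.sqrt a * ‖QU f‖ - Real.sqrt a * ‖QV f‖|) := key
    _ ≤ NV + (d₁ * NV + (d₂ + dR * (1 + CP)) * NV + Real.sqrt a * dQ * NV) := by linarith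
    _ = (1 + (d₁ + d₂ + dR * (1 + CP) + Real.sqrt a * dQ)) * NV := by ring

end Literature.MathematicalPhysics.QuantumFieldTheory.Balaban1983to89.B9Eq326ConjugatedDeltaAFormDefect

end
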